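import Literature.MathematicalPhysics.QuantumFieldTheory.Balaban1983to89.B9Thm313WholeL2GP
import Literature.MathematicalPhysics.QuantumFieldTheory.Balaban1983to89.B9Thm313WholeL2GZ

/-!
# `Balaban1983to89.B9Thm313WholeL2GPZ` — [B9] Theorem 3.13 (p. 426), DIRECTION-PAIR block-L² lines of 𝔊 with the COARSE-SIDE block-L² letters
# RE-WEIGHTED (Z-twin of `B9Thm313WholeL2GP`; R1-cls extended to the (3.46) line, sequel of `B9Thm313WholeL2GZ`)

T. Bałaban, *Propagators for lattice gauge theories in a background field*, Commun. Math. Phys. **99** (1985) 389–434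
[`Balaban1985BackgroundPropagators`, "B9"]; [4] = T. Bałaban, *Propagators and renormalization transformations for lattice
gauge theories. II*, Commun. Math. Phys. **96** (1984) 223–250 [`Balaban1984PropagatorsII`].  statement-level skeleton of published
theorems with citation tags; proofs where landed; nothing here is a claim about the Yang–Mills mass gap.

THE POINT.  As `B9Thm313WholeL2GZ`, for the pair-indexed letters: `Letters313L2PZ … vZ hvZ U` (`gQs ∕ ddGQs ∕ dGQs ∕ c1 ∕ q` re-weighted by the free
`vZ`), `Letters313L2PZ.toLap`, `letters313L2PZ_mono`, and the lines ★ `GG_l2bd_leftZ` (`hEGQs` re-weighted), ★ `GG_l2bd_rightZ` (the family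
packagings `GG_l2bd_family3Z ∕ 5Z` are in `B9Thm313WholeDirL2Z`) — SAME conclusions and constants; proofs verbatim but for the Z-side weights.  `Thm33G0L2P` and its lemmas are UNCHANGED
(imported).  `vZ ≡ 1` recovers the flat statements.

HONEST SCOPE.  Nothing of print is asserted: every analytic input is a HYPOTHESIS of printed ∕ md shape; kernel-checked bookkeeping.  NOT a node discharge,
NOT summit progress; one finite lattice at a time; nothing continuum, nothing about the mass gap.  Cell `pub-ymgap` (HUMAN RULING D-0062), Track A node
N06 [B9], N06-ASSIGNMENT v1 row 21 (bundle F7), seat `pub-ymgap-dag-n06-l` (g14), 2026-08-27.  NEW file; nothing landed is modified.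
-/

namespace Literature.MathematicalPhysics.QuantumFieldTheory.Balaban1983to89.B9Thm313WholeL2GPZ

open Literature.MathematicalPhysics.QuantumFieldTheory.Balaban1983to89
open Finset B6RandomWalk B6RandomWalkHom B9Thm34Ext B9Thm37GlueCor36 B11SectG B9SectDSup B9SectDL2Decay
open B9Thm37AllNorms B9Thm37AllNormsInstances B9Thm312Whole B9Thm312WholeLeaf B9Thm312WholeLeft B9Thm313Whole B9Thm313WholeLeft B9Ineq347
open B9Thm312WholeClasses B9Thm312WholeL2 B9Thm313WholeHolder B9Thm313WholeL2G B9Thm312WholeBlocksNbr B9RWSums346SecondDiff B9Thm313WholeL2GP B9Thm313WholeL2GZ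

noncomputable section

section L2GP

variable {g : B9.Geometry} {B : B9.Backgrounds} {X Y Z W P : Type} [Fintype X] [Fintype Y] [Fintype Z] [Fintype W]
  [Fintype g.Site]
variable {R₀ : ℝ} {H₀ : Prop}

/-! ## §1 The pair letters, coarse side re-weighted (printed shape; nothing asserted) -/

/-- (**Z-FORM**: `B9Thm313WholeL2GP.Letters313L2P` with the coarse-side block-L² classes re-weighted by one free positive weight `vZ` — `gQs ∕ ddGQs ∕ dGQs ∕
c1 ∕ q` carry `vZ·len` for every coarse block index; the knit pins `vZ := n^{−1∕2}`; `vZ ≡ 1` is the old schema) ★ **THE BLOCK-L² LETTERS OF THEOREM 3.13's REDUCTION AT U, SECOND-ORDER PIECES PER DIRECTION PAIR** (p. 426) — `B9Thm313WholeL2G.Letters313L2`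
with its three Laplacian fields replaced by the families over the pairs q = (ν, μ) ∈ P × P: `gDv`, `dGDv`, `gQs`, `dGQs`, `rgdI`, `rgdDs`, `c1`, `q`
verbatim; `ddGDv q` — ∇_{U,ν}∇_{U,μ}G₀D (factor (Lʲη)⁻¹); `ddGQs q` — ∇_{U,ν}∇_{U,μ}G₀Q* (factor L^{j′}η∕Lʲη); `rgdDds q` — RD*G₁∇\*_{U,ν}∇\*_{U,μ}
((3.152); factor (L^{j′}η)⁻¹).  NOTHING ASSERTED: these are the instance's (Theorem 3.1, (3.49), (3.126), (3.132), (3.152)).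
[cite: Balaban1985BackgroundPropagators, Thm 3.13 p.426 + (3.152)–(3.153) p.426 + (3.132) p.422 + (3.126) p.420 + (3.46) p.398 + (3.39) p.397 + p.398 (remark after (3.47)); Balaban1984PropagatorsII, (2.26) p.228] -/
structure Letters313L2PZ (𝔬 : Ops g B X Y Z W) (Dd Dds : B.Cfg → P → Module.End ℝ (X → ℝ)) (R₀ : ℝ) (H₀ : Prop) (B₄ δ : ℝ)
    (vZ : g.Site → ℝ) (hvZ : ∀ y, 0 < vZ y) (U : B.Cfg) : Prop where
  gDv : BlockBd (g := toB6 g R₀ H₀) 𝔬.blkW 𝔬.blk (𝔬.G0 U ∘ₗ 𝔬.Dv U)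
    (fun (y y' : g.Site) => B₄ * g.len y * Real.exp (-(δ * g.dist y y')))
  ddGDv : ∀ q : P × P, BlockBd (g := toB6 g R₀ H₀) 𝔬.blkW 𝔬.blk ((Dd U q.1 ∘ₗ Dd U q.2) ∘ₗ 𝔬.G0 U ∘ₗ 𝔬.Dv U)
    (fun (y y' : g.Site) => B₄ * (g.len y)⁻¹ * Real.exp (-(δ * g.dist y y')))
  dGDv : BlockBd (g := toB6 g R₀ H₀) 𝔬.blkW 𝔬.blkY (𝔬.D U ∘ₗ 𝔬.G0 U ∘ₗ 𝔬.Dv U)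
    (fun (y y' : g.Site) => B₄ * Real.exp (-(δ * g.dist y y')))
  gQs : BlockBd (g := toB6 g R₀ H₀) 𝔬.blkZ 𝔬.blk (𝔬.G0 U ∘ₗ 𝔬.Qstar U)
    (fun (y y' : g.Site) => B₄ * g.len y * (vZ y' * g.len y') * Real.exp (-(δ * g.dist y y')))
  ddGQs : ∀ q : P × P, BlockBd (g := toB6 g R₀ H₀) 𝔬.blkZ 𝔬.blk ((Dd U q.1 ∘ₗ Dd U q.2) ∘ₗ 𝔬.G0 U ∘ₗ 𝔬.Qstar U)
    (fun (y y' : g.Site) => B₄ * ((g.len y)⁻¹ * (vZ y' * g.len y')) * Real.exp (-(δ * g.dist y y')))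
  dGQs : BlockBd (g := toB6 g R₀ H₀) 𝔬.blkZ 𝔬.blkY (𝔬.D U ∘ₗ 𝔬.G0 U ∘ₗ 𝔬.Qstar U)
    (fun (y y' : g.Site) => B₄ * (vZ y' * g.len y') * Real.exp (-(δ * g.dist y y')))
  rgdI : BlockBd (g := toB6 g R₀ H₀) 𝔬.blk 𝔬.blkW (𝔬.R U ∘ₗ 𝔬.Dvstar U ∘ₗ 𝔬.G1 U ∘ₗ LinearMap.id)
    (fun (y y' : g.Site) => B₄ * g.len y' * Real.exp (-(δ * g.dist y y')))
  rgdDs : BlockBd (g := toB6 g R₀ H₀) 𝔬.blkY 𝔬.blkW (𝔬.R U ∘ₗ 𝔬.Dvstar U ∘ₗ 𝔬.G1 U ∘ₗ 𝔬.Dstar U)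
    (fun (y y' : g.Site) => B₄ * Real.exp (-(δ * g.dist y y')))
  rgdDds : ∀ q : P × P, BlockBd (g := toB6 g R₀ H₀) 𝔬.blk 𝔬.blkW (𝔬.R U ∘ₗ 𝔬.Dvstar U ∘ₗ 𝔬.G1 U ∘ₗ (Dds U q.1 ∘ₗ Dds U q.2))
    (fun (y y' : g.Site) => B₄ * (g.len y')⁻¹ * Real.exp (-(δ * g.dist y y')))
  c1 : BlockBd (g := toB6 g R₀ H₀) 𝔬.blkZ 𝔬.blkZ (𝔬.C1 U)
    (fun (y y' : g.Site) => B₄ * (vZ y * g.len y)⁻¹ * (vZ y' * g.len y')⁻¹ * Real.exp (-(δ * g.dist y y')))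
  q : BlockBd (g := toB6 g R₀ H₀) 𝔬.blk 𝔬.blkZ (𝔬.Q U)
    (fun (y y' : g.Site) => B₄ * (vZ y * g.len y * (g.len y')⁻¹) * Real.exp (-(δ * g.dist y y')))

/-- the Laplacian-free re-weighted letters as a `Letters313L2Z` record at the ZERO Laplacian letter (its three Laplacian fields hold trivially), for the
sibling lemmas that read only those (`GG_l2bd_entry4`). [cite: Balaban1985BackgroundPropagators, (3.46) p.398 (bookkeeping)] -/
theorem Letters313L2PZ.toLap {𝔬 : Ops g B X Y Z W} {Dd Dds : B.Cfg → P → Module.End ℝ (X → ℝ)} {B₄ δ : ℝ} {U : B.Cfg}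
    (hB₄ : 0 ≤ B₄) (hlen : ∀ y : g.Site, 0 ≤ g.len y) {vZ : g.Site → ℝ} {hvZ : ∀ y, 0 < vZ y}
    (h : Letters313L2PZ 𝔬 Dd Dds R₀ H₀ B₄ δ vZ hvZ U) :
    Letters313L2Z 𝔬 (fun _ => (0 : Module.End ℝ (X → ℝ))) R₀ H₀ B₄ δ vZ hvZ U := by
  have hz : ∀ {V V' : Type} [Fintype V] [Fintype V'] (bv : V → g.Site) (bv' : V' → g.Site) (K : g.Site → g.Site → ℝ),
      (∀ a b, 0 ≤ K a b) → BlockBd (g := toB6 g R₀ H₀) bv bv' (0 : (V → ℝ) →ₗ[ℝ] (V' → ℝ)) K := by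
    intro V V' _ _ bv bv' K hK y' μ _ y
    rw [LinearMap.zero_apply, bl2_zero]
    exact mul_nonneg (hK y y') (bl2_nonneg _ _ _)
  have hli : ∀ y : g.Site, 0 ≤ (g.len y)⁻¹ := fun y => inv_nonneg.mpr (hlen y)
  refine
    { gDv := h.gDv
      dGDv := h.dGDv
      gQs := h.gQs
      dGQs := h.dGQs
      rgdI := h.rgdI
      rgdDs := h.rgdDs
      c1 := h.c1
      q := h.q
      lapGDv := ?_
      lapGQs := ?_
      rgdLap := ?_ }
  · rw [LinearMap.zero_comp]
    exact hz _ _ _ fun a b => mul_nonneg (mul_nonneg hB₄ (hli a)) (Real.exp_nonneg _)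
  · rw [LinearMap.zero_comp]
    exact hz _ _ _ fun a b => mul_nonneg (mul_nonneg hB₄ (mul_nonneg (hli a) (mul_nonneg (hvZ b).le (hlen b)))) (Real.exp_nonneg _)
  · rw [LinearMap.comp_zero, LinearMap.comp_zero, LinearMap.comp_zero]
    exact hz _ _ _ fun a b => mul_nonneg (mul_nonneg hB₄ (hli b)) (Real.exp_nonneg _)

/-- the pair letters at a slower rate (e^{−δd} ≦ e^{−δ′d} for δ′ ≦ δ, d ≧ 0). [cite: Balaban1985BackgroundPropagators, (3.46) p.398 (bookkeeping)] -/
theorem letters313L2PZ_mono {𝔬 : Ops g B X Y Z W} {Dd Dds : B.Cfg → P → Module.End ℝ (X → ℝ)} {B₄ δ δ' : ℝ} {U : B.Cfg}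
    (hG : GeoOK g) (hB₄ : 0 ≤ B₄) (hδ : δ' ≤ δ) {vZ : g.Site → ℝ} {hvZ : ∀ y, 0 < vZ y} (h : Letters313L2PZ 𝔬 Dd Dds R₀ H₀ B₄ δ vZ hvZ U) :
    Letters313L2PZ 𝔬 Dd Dds R₀ H₀ B₄ δ' vZ hvZ U := by
  have hexp : ∀ y y' : g.Site, Real.exp (-(δ * g.dist y y')) ≤ Real.exp (-(δ' * g.dist y y')) := fun y y' =>
    Real.exp_le_exp.mpr (neg_le_neg (mul_le_mul_of_nonneg_right hδ (hG.dnn y y')))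
  have hl : ∀ y : g.Site, 0 ≤ g.len y := hG.lenle
  have hli : ∀ y : g.Site, 0 ≤ (g.len y)⁻¹ := fun y => inv_nonneg.mpr (hl y)
  have hv : ∀ y : g.Site, 0 ≤ vZ y * g.len y := fun y => (mul_pos (hvZ y) (hG.lenpos y)).le
  have hvi : ∀ y : g.Site, 0 ≤ (vZ y * g.len y)⁻¹ := fun y => inv_nonneg.mpr (hv y)
  exact
    { gDv := h.gDv.mono fun y y' => mul_le_mul_of_nonneg_left (hexp y y') (mul_nonneg hB₄ (hl y))
      ddGDv := fun q => (h.ddGDv q).mono fun y y' => mul_le_mul_of_nonneg_left (hexp y y') (mul_nonneg hB₄ (hli y))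
      dGDv := h.dGDv.mono fun y y' => mul_le_mul_of_nonneg_left (hexp y y') hB₄
      gQs := h.gQs.mono fun y y' => mul_le_mul_of_nonneg_left (hexp y y') (mul_nonneg (mul_nonneg hB₄ (hl y)) (hv y'))
      ddGQs := fun q => (h.ddGQs q).mono fun y y' => mul_le_mul_of_nonneg_left (hexp y y') (mul_nonneg hB₄ (mul_nonneg (hli y) (hv y')))
      dGQs := h.dGQs.mono fun y y' => mul_le_mul_of_nonneg_left (hexp y y') (mul_nonneg hB₄ (hv y'))
      rgdI := h.rgdI.mono fun y y' => mul_le_mul_of_nonneg_left (hexp y y') (mul_nonneg hB₄ (hl y'))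
      rgdDs := h.rgdDs.mono fun y y' => mul_le_mul_of_nonneg_left (hexp y y') hB₄
      rgdDds := fun q => (h.rgdDds q).mono fun y y' => mul_le_mul_of_nonneg_left (hexp y y') (mul_nonneg hB₄ (hli y'))
      c1 := h.c1.mono fun y y' => mul_le_mul_of_nonneg_left (hexp y y') (mul_nonneg (mul_nonneg hB₄ (hvi y)) (hvi y'))
      q := h.q.mono fun y y' => mul_le_mul_of_nonneg_left (hexp y y') (mul_nonneg hB₄ (mul_nonneg (hv y) (hli y'))) }

/-! ## §2 The lines over the re-weighted letters -/

/-- ★ (**Z-TWIN**, coarse block-L² classes re-weighted by the free `vZ` of `Letters313L2Z`; statement and proof otherwise verbatim) **A SECOND-ORDER L² LINE OF 𝔊 = 𝔓G₁ WITH A GENERIC LEFT LETTER** E : 𝔩(X) → 𝔩(X₃) (∇_ν∇_μ, Δ_U, …): (3.153) with the left factor E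
(`E_GG_eq`), the G₁-entries EG₁, EG₁D, EG₁Q*, G₁ by r1's Neumann bookkeeping from Theorem 3.3 for G₀ and the step (`entry_l2w_of_step`; the
E-specific bounds of E∘G₀ (`hE3`, ratio class), E∘G₀D (`hEGDv`), E∘G₀Q* (`hEGQs`) as explicit hypotheses of printed shape), the letters RD*G₁, C₁, Q,
composed by `hasMaj_frakG_classes` in the block-L² classes Lʲη → Lʲη, then the scale transfer (2.60) of p. 398 (`blockBd_transfer`, constant Λ):
block bound `constG46 (constKp B₂ B₄ θ c) c`·Λ·e^{−(ρ−αρ₀)d(y,y′)} between `blk` and `blk₃`; provisos ρ + 5σ ≦ δ, B₂θc² < 1 (the abstraction of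
`GG_l2bd_entry3` from Δ_U to any E). [cite: Balaban1985BackgroundPropagators, Thm 3.13 p.426 + (3.153) p.426 + (3.46) p.398 + p.398 (remark after (3.47)); Balaban1984PropagatorsII, Lemma 2.1 (2.60)–(2.61) p.234] -/
theorem GG_l2bd_leftZ (hG : GeoOK g) {𝔬 : Ops g B X Y Z W} {Lap : B.Cfg → Module.End ℝ (X → ℝ)} {U : B.Cfg}
    {X₃ : Type} [Fintype X₃] {blk₃ : X₃ → g.Site} {E : (X → ℝ) →ₗ[ℝ] (X₃ → ℝ)}
    {B₂ B₄ θ δ ρ ρ₀ α Λ σ c : ℝ} (hrow : RowSum (toB6 g R₀ H₀) σ c) (hB₂ : 0 ≤ B₂) (hB₄ : 0 ≤ B₄) (hθ : 0 ≤ θ) (hρ : 0 ≤ ρ)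
    (hσ : 0 ≤ σ) (hρδ : ρ + 5 * σ ≤ δ) (hST : ScaleTransfer g ρ₀ α Λ (fun y => g.len y ^ (1 : ℝ)))
    (hL : Thm33G0L2 𝔬 Lap R₀ H₀ B₂ δ U)
    (hT : BlockBd (g := toB6 g R₀ H₀) 𝔬.blk 𝔬.blk (𝔬.Tpi U + 𝔬.T2 U)
      (fun (y y' : g.Site) => θ * (g.len y)⁻¹ * (g.len y')⁻¹ * Real.exp (-(δ * g.dist y y'))))
    {vZ : g.Site → ℝ} {hvZ : ∀ y, 0 < vZ y}
    (hLt : Letters313L2Z 𝔬 Lap R₀ H₀ B₄ δ vZ hvZ U)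
    (hE3 : BlockBd (g := toB6 g R₀ H₀) 𝔬.blk blk₃ (E ∘ₗ 𝔬.G0 U)
      (fun (y y' : g.Site) => B₂ * ((g.len y)⁻¹ * g.len y') * Real.exp (-(δ * g.dist y y'))))
    (hEGDv : BlockBd (g := toB6 g R₀ H₀) 𝔬.blkW blk₃ (E ∘ₗ 𝔬.G0 U ∘ₗ 𝔬.Dv U)
      (fun (y y' : g.Site) => B₄ * (g.len y)⁻¹ * Real.exp (-(δ * g.dist y y'))))
    (hEGQs : BlockBd (g := toB6 g R₀ H₀) 𝔬.blkZ blk₃ (E ∘ₗ 𝔬.G0 U ∘ₗ 𝔬.Qstar U)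
      (fun (y y' : g.Site) => B₄ * ((g.len y)⁻¹ * (vZ y' * g.len y')) * Real.exp (-(δ * g.dist y y'))))
    (hI : Identities 𝔬 U) (hq : B₂ * θ * c * c < 1) :
    BlockBd (g := toB6 g R₀ H₀) 𝔬.blk blk₃ (E ∘ₗ 𝔬.GG U)
      (fun (y y' : g.Site) => constG46 (constKp B₂ B₄ θ c) c * Λ * Real.exp (-((ρ - α * ρ₀) * g.dist y y'))) := by
  -- adapted from `B9Thm313WholeL2G.GG_l2bd_entry3` (Δ_U ↦ E)
  have hc : 0 ≤ c ∨ IsEmpty g.Site := by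
    by_cases hne : Nonempty g.Site
    · exact Or.inl (hrow.nonneg hne.some)
    · exact Or.inr (not_nonempty_iff.mp hne)
  rcases hc with hc | hemp
  swap
  · intro y' μ hμ y
    exact (hemp.false y).elim
  have htri : Triangle254 (toB6 g R₀ H₀) := fun a b c => hG.tri a b c
  have hW1 : ∀ y : g.Site, 0 < (fun _ : g.Site => (1 : ℝ)) y := fun _ => one_pos
  have hWl : ∀ y : g.Site, 0 < (fun y : g.Site => g.len y) y := fun y => hG.lenpos y
  have hWi : ∀ y : g.Site, 0 < (fun y : g.Site => (g.len y)⁻¹) y := fun y => inv_pos.mpr (hG.lenpos y)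
  have hWv : ∀ y : g.Site, 0 < (fun y : g.Site => vZ y * g.len y) y := fun y => mul_pos (hvZ y) (hG.lenpos y)
  have hWvi : ∀ y : g.Site, 0 < (fun y : g.Site => (vZ y * g.len y)⁻¹) y := fun y => inv_pos.mpr (mul_pos (hvZ y) (hG.lenpos y))
  have hfix : 𝔬.G1 U = 𝔬.G0 U + 𝔬.G0 U ∘ₗ (𝔬.Tpi U + 𝔬.T2 U) ∘ₗ 𝔬.G1 U := fix_of_inverses hI.invG0' hI.invG1
  -- constants
  have hS0 : 0 ≤ B₂ + B₄ := add_nonneg hB₂ hB₄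
  have hS₂ : B₂ ≤ B₂ + B₄ := by linarith
  have hS₄ : B₄ ≤ B₂ + B₄ := by linarith
  obtain ⟨hKp0, -⟩ := constP_nonneg_le hθ hc hq hS0 hS0 hS0 le_rfl le_rfl le_rfl
  obtain ⟨hP₂0, hP₂le⟩ := constP_nonneg_le hθ hc hq hB₂ hB₂ hB₂ hS₂ hS₂ hS₂
  obtain ⟨hP₄0, hP₄le⟩ := constP_nonneg_le hθ hc hq hB₄ hB₂ hB₄ hS₄ hS₂ hS₄
  have hB₄K : B₄ ≤ constP B₂ θ c (B₂ + B₄) (B₂ + B₄) (B₂ + B₄) := by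
    have hq1 : 0 ≤ (1 - B₂ * θ * c * c)⁻¹ := inv_nonneg.mpr (by linarith)
    have h0 : 0 ≤ (B₂ + B₄) * (θ * ((B₂ + B₄) * (1 - B₂ * θ * c * c)⁻¹) * c) * c :=
      mul_nonneg (mul_nonneg hS0 (mul_nonneg (mul_nonneg hθ (mul_nonneg hS0 hq1)) hc)) hc
    unfold constP; linarith
  have hKK0 : 0 ≤ constP B₂ θ c (B₂ + B₄) (B₂ + B₄) (B₂ + B₄) * constP B₂ θ c (B₂ + B₄) (B₂ + B₄) (B₂ + B₄) * c :=
    mul_nonneg (mul_nonneg hKp0 hKp0) hc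
  have hKG0 : 0 ≤ constG46 (constKp B₂ B₄ θ c) c := constG46_nonneg hKp0 hc
  -- rates
  have hr₁0 : 0 ≤ ρ + 3 * σ := by linarith
  have hr₁δ : ρ + 3 * σ + 2 * σ ≤ δ := by linarith
  have hr₂0 : 0 ≤ ρ + 2 * σ := by linarith
  have hr₂1 : ρ + 2 * σ ≤ ρ + 3 * σ := by linarith
  have hr₂δ' : ρ + 2 * σ + σ ≤ δ := by linarith
  have hr₂δ : ρ + 2 * σ ≤ δ := by linarith
  have hρr₂ : ρ + 2 * σ ≤ ρ + 2 * σ := le_rfl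
  -- the G₁-entries EG₁, EG₁D, EG₁Q*, G₁ by r1's Neumann bookkeeping, at the rate ρ + 3σ
  have pG := entry_l2w_of_step hG hWl hWl (Eop := E) (Fop := LinearMap.id) (aS := B₂) (aE := B₂) (aEF := B₂) hrow hB₂
    hθ hB₂ hB₂ hB₂ hr₁0 hσ hr₁δ hL hT (by rw [LinearMap.comp_id]; exact hL.l0.mono fun y y' => le_of_eq (by ring))
    (hE3.mono fun y y' => le_of_eq (by ring))
    (by rw [LinearMap.comp_id]; exact hE3.mono fun y y' => le_of_eq (by ring)) hfix hq
  have pGD := entry_l2w_of_step hG hW1 hWl (Eop := E) (Fop := 𝔬.Dv U) (aS := B₄) (aE := B₂) (aEF := B₄) hrow hB₂ hθ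
    hB₄ hB₂ hB₄ hr₁0 hσ hr₁δ hL hT (hLt.gDv.mono fun y y' => le_of_eq (by ring)) (hE3.mono fun y y' => le_of_eq (by ring))
    (hEGDv.mono fun y y' => le_of_eq (by ring)) hfix hq
  have pGQ := entry_l2w_of_step hG hWv hWl (Eop := E) (Fop := 𝔬.Qstar U) (aS := B₄) (aE := B₂) (aEF := B₄) hrow hB₂ hθ
    hB₄ hB₂ hB₄ hr₁0 hσ hr₁δ hL hT (hLt.gQs.mono fun y y' => le_of_eq (by ring)) (hE3.mono fun y y' => le_of_eq (by ring))
    (hEGQs.mono fun y y' => le_of_eq (by ring)) hfix hq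
  have pG1 := entry_l2w_of_step hG hWl hWi (Eop := LinearMap.id) (Fop := LinearMap.id) (aS := B₂) (aE := B₂) (aEF := B₂)
    hrow hB₂ hθ hB₂ hB₂ hB₂ hr₁0 hσ hr₁δ hL hT
    (by rw [LinearMap.comp_id]; exact hL.l0.mono fun y y' => le_of_eq (by ring))
    (by rw [LinearMap.id_comp]; exact hL.l0.mono fun y y' => le_of_eq (by rw [inv_inv]; ring))
    (by rw [LinearMap.id_comp, LinearMap.comp_id]; exact hL.l0.mono fun y y' => le_of_eq (by rw [inv_inv]; ring)) hfix hq
  rw [LinearMap.id_comp] at pG1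
  -- the letters RD*G₁, C₁, Q in the block-L² classes
  have pRG : HasMaj (l2w (toB6 g R₀ H₀) 𝔬.blk (fun y : g.Site => g.len y) fun y => (hWl y).le)
      (l2w (toB6 g R₀ H₀) 𝔬.blkW (fun _ : g.Site => (1 : ℝ)) fun y => (hW1 y).le)
      (𝔬.R U ∘ₗ 𝔬.Dvstar U ∘ₗ 𝔬.G1 U ∘ₗ LinearMap.id) (fun y y' => B₄ * Real.exp (-(δ * g.dist y y'))) :=
    hasMaj_l2w_of_blockBd_ratio (g := toB6 g R₀ H₀) hWl hW1 (hLt.rgdI.mono fun y y' => le_of_eq (by ring))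
  have pC : HasMaj (l2w (toB6 g R₀ H₀) 𝔬.blkZ (fun y : g.Site => (vZ y * g.len y)⁻¹) fun y => (hWvi y).le)
      (l2w (toB6 g R₀ H₀) 𝔬.blkZ (fun y : g.Site => vZ y * g.len y) fun y => (hWv y).le)
      (𝔬.C1 U) (fun y y' => B₄ * Real.exp (-(δ * g.dist y y'))) :=
    hasMaj_l2w_of_blockBd_ratio (g := toB6 g R₀ H₀) hWvi hWv (hLt.c1.mono fun y y' => le_of_eq (by ring))
  have pQ : HasMaj (l2w (toB6 g R₀ H₀) 𝔬.blk (fun y : g.Site => (g.len y)⁻¹) fun y => (hWi y).le)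
      (l2w (toB6 g R₀ H₀) 𝔬.blkZ (fun y : g.Site => (vZ y * g.len y)⁻¹) fun y => (hWvi y).le)
      (𝔬.Q U) (fun y y' => B₄ * Real.exp (-(δ * g.dist y y'))) :=
    hasMaj_l2w_of_blockBd_ratio (g := toB6 g R₀ H₀) hWi hWvi (hLt.q.mono fun y y' => le_of_eq (by rw [inv_inv]; ring))
  -- QG₁ at the rate ρ + 2σ
  have pQG := hasMaj_comp_exp htri hG.dnn hrow hB₄ hP₂0 hr₂0 hr₂1 hr₂δ' pQ pG1
  simp only [l2w_κ, one_mul] at pQG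
  -- everything at (K_p, ρ + 2σ), the composite at K_p²c
  have uG := hasMaj_up hG hP₂0 hP₂le hr₂1 pG
  have uGD := hasMaj_up hG hP₄0 hP₄le hr₂1 pGD
  have uRG := hasMaj_up hG hB₄ hB₄K hr₂δ pRG
  have uGQ := hasMaj_up hG hP₄0 hP₄le hr₂1 pGQ
  have uC := hasMaj_up hG hB₄ hB₄K hr₂δ pC
  have uQG := hasMaj_up hG (mul_nonneg (mul_nonneg hB₄ hP₂0) hc)
    (mul_le_mul_of_nonneg_right (mul_le_mul hB₄K hP₂le hP₂0 hKp0) hc) hρr₂ pQG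
  -- (3.153) composed in the block-L² classes, then unweighted and transferred
  have hfr := hasMaj_frakG_classes htri hG.dnn hrow hKp0 hKp0 hKp0 hKp0 hKp0 hKK0 hρ hσ hρr₂ uG uGD uRG uGQ uC uQG
  have hGG := hfr.congr (T' := E ∘ₗ 𝔬.GG U) fun μ => by rw [E_GG_eq hI E]
  have hbd := blockBd_of_hasMaj_l2w hGG hWl
  have h' : BlockBd (g := toB6 g R₀ H₀) 𝔬.blk blk₃ (E ∘ₗ 𝔬.GG U)
      (fun (y y' : g.Site) => constG46 (constKp B₂ B₄ θ c) c * (g.len y' ^ (1 : ℝ) * (g.len y ^ (1 : ℝ))⁻¹) *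
        Real.exp (-(ρ * g.dist y y'))) :=
    hbd.mono fun y y' => le_of_eq (by
      simp only [l2w_κ, one_mul, toB6_dist, constG46, constKp, Real.rpow_one, div_eq_mul_inv]; ring)
  exact blockBd_transfer (C := fun _ _ => constG46 (constKp B₂ B₄ θ c) c) (fun _ _ => hKG0)
    (fun z => Real.rpow_pos_of_pos (hG.lenpos z) 1) hST h'

/-- ★ (**Z-TWIN**, coarse block-L² classes re-weighted by the free `vZ` of `Letters313L2Z`; statement and proof otherwise verbatim) **A SECOND-ORDER L² LINE OF 𝔊 = 𝔓G₁ WITH A GENERIC RIGHT LETTER** F : 𝔩(X₀) → 𝔩(X) (∇\*_ν∇\*_μ, Δ_U, …): (3.153) with the right factor F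
(`GG_comp_eq`), the G₁-entries G₁F, G₁D, G₁Q* from Theorem 3.3 for G₀ and the step (`entry_l2w_of_step`; the F-specific bounds of G₀∘F (`hF5`, ratio
class) and RD*G₁F (`hrgdF`) as explicit hypotheses of printed shape), the letters C₁, Q, composed by `hasMaj_frakG_classes` in the block-L² classes
(Lʲη)⁻¹ → (Lʲη)⁻¹, then the scale transfer (2.60) at the weight (Lʲη)⁻¹ (constant Λ′): block bound `constG46 (constKp B₂ B₄ θ c) c`·Λ′·e^{−(ρ−αρ₀)d}
between `blk₀` and `blk`; provisos ρ + 5σ ≦ δ, B₂θc² < 1 (the abstraction of `GG_l2bd_entry5` from Δ_U to any F).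
[cite: Balaban1985BackgroundPropagators, Thm 3.13 p.426 + (3.153) p.426 + (3.46) p.398 + p.398 (remark after (3.47)); Balaban1984PropagatorsII, Lemma 2.1 (2.60)–(2.61) p.234] -/
theorem GG_l2bd_rightZ (hG : GeoOK g) {𝔬 : Ops g B X Y Z W} {Lap : B.Cfg → Module.End ℝ (X → ℝ)} {U : B.Cfg}
    {X₀ : Type} [Fintype X₀] {blk₀ : X₀ → g.Site} {F : (X₀ → ℝ) →ₗ[ℝ] (X → ℝ)}
    {B₂ B₄ θ δ ρ ρ₀ α Λ σ c : ℝ} (hrow : RowSum (toB6 g R₀ H₀) σ c) (hB₂ : 0 ≤ B₂) (hB₄ : 0 ≤ B₄) (hθ : 0 ≤ θ) (hρ : 0 ≤ ρ)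
    (hσ : 0 ≤ σ) (hρδ : ρ + 5 * σ ≤ δ) (hST : ScaleTransfer g ρ₀ α Λ (fun y => g.len y ^ (-1 : ℝ)))
    (hL : Thm33G0L2 𝔬 Lap R₀ H₀ B₂ δ U)
    (hT : BlockBd (g := toB6 g R₀ H₀) 𝔬.blk 𝔬.blk (𝔬.Tpi U + 𝔬.T2 U)
      (fun (y y' : g.Site) => θ * (g.len y)⁻¹ * (g.len y')⁻¹ * Real.exp (-(δ * g.dist y y'))))
    {vZ : g.Site → ℝ} {hvZ : ∀ y, 0 < vZ y}
    (hLt : Letters313L2Z 𝔬 Lap R₀ H₀ B₄ δ vZ hvZ U)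
    (hF5 : BlockBd (g := toB6 g R₀ H₀) blk₀ 𝔬.blk (𝔬.G0 U ∘ₗ F)
      (fun (y y' : g.Site) => B₂ * (g.len y * (g.len y')⁻¹) * Real.exp (-(δ * g.dist y y'))))
    (hrgdF : BlockBd (g := toB6 g R₀ H₀) blk₀ 𝔬.blkW (𝔬.R U ∘ₗ 𝔬.Dvstar U ∘ₗ 𝔬.G1 U ∘ₗ F)
      (fun (y y' : g.Site) => B₄ * (g.len y')⁻¹ * Real.exp (-(δ * g.dist y y'))))
    (hI : Identities 𝔬 U) (hq : B₂ * θ * c * c < 1) :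
    BlockBd (g := toB6 g R₀ H₀) blk₀ 𝔬.blk (𝔬.GG U ∘ₗ F)
      (fun (y y' : g.Site) => constG46 (constKp B₂ B₄ θ c) c * Λ * Real.exp (-((ρ - α * ρ₀) * g.dist y y'))) := by
  -- adapted from `B9Thm313WholeL2G.GG_l2bd_entry5` (Δ_U ↦ F)
  have hc : 0 ≤ c ∨ IsEmpty g.Site := by
    by_cases hne : Nonempty g.Site
    · exact Or.inl (hrow.nonneg hne.some)
    · exact Or.inr (not_nonempty_iff.mp hne)
  rcases hc with hc | hemp
  swap
  · intro y' μ hμ y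
    exact (hemp.false y).elim
  have htri : Triangle254 (toB6 g R₀ H₀) := fun a b c => hG.tri a b c
  have hW1 : ∀ y : g.Site, 0 < (fun _ : g.Site => (1 : ℝ)) y := fun _ => one_pos
  have hWl : ∀ y : g.Site, 0 < (fun y : g.Site => g.len y) y := fun y => hG.lenpos y
  have hWi : ∀ y : g.Site, 0 < (fun y : g.Site => (g.len y)⁻¹) y := fun y => inv_pos.mpr (hG.lenpos y)
  have hWv : ∀ y : g.Site, 0 < (fun y : g.Site => vZ y * g.len y) y := fun y => mul_pos (hvZ y) (hG.lenpos y)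
  have hWvi : ∀ y : g.Site, 0 < (fun y : g.Site => (vZ y * g.len y)⁻¹) y := fun y => inv_pos.mpr (mul_pos (hvZ y) (hG.lenpos y))
  have hfix : 𝔬.G1 U = 𝔬.G0 U + 𝔬.G0 U ∘ₗ (𝔬.Tpi U + 𝔬.T2 U) ∘ₗ 𝔬.G1 U := fix_of_inverses hI.invG0' hI.invG1
  -- constants
  have hS0 : 0 ≤ B₂ + B₄ := add_nonneg hB₂ hB₄
  have hS₂ : B₂ ≤ B₂ + B₄ := by linarith
  have hS₄ : B₄ ≤ B₂ + B₄ := by linarith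
  obtain ⟨hKp0, -⟩ := constP_nonneg_le hθ hc hq hS0 hS0 hS0 le_rfl le_rfl le_rfl
  obtain ⟨hP₂0, hP₂le⟩ := constP_nonneg_le hθ hc hq hB₂ hB₂ hB₂ hS₂ hS₂ hS₂
  obtain ⟨hP₄0, hP₄le⟩ := constP_nonneg_le hθ hc hq hB₄ hB₂ hB₄ hS₄ hS₂ hS₄
  have hB₄K : B₄ ≤ constP B₂ θ c (B₂ + B₄) (B₂ + B₄) (B₂ + B₄) := by
    have hq1 : 0 ≤ (1 - B₂ * θ * c * c)⁻¹ := inv_nonneg.mpr (by linarith)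
    have h0 : 0 ≤ (B₂ + B₄) * (θ * ((B₂ + B₄) * (1 - B₂ * θ * c * c)⁻¹) * c) * c :=
      mul_nonneg (mul_nonneg hS0 (mul_nonneg (mul_nonneg hθ (mul_nonneg hS0 hq1)) hc)) hc
    unfold constP; linarith
  have hKK0 : 0 ≤ constP B₂ θ c (B₂ + B₄) (B₂ + B₄) (B₂ + B₄) * constP B₂ θ c (B₂ + B₄) (B₂ + B₄) (B₂ + B₄) * c :=
    mul_nonneg (mul_nonneg hKp0 hKp0) hc
  have hKG0 : 0 ≤ constG46 (constKp B₂ B₄ θ c) c := constG46_nonneg hKp0 hc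
  -- rates
  have hr₁0 : 0 ≤ ρ + 3 * σ := by linarith
  have hr₁δ : ρ + 3 * σ + 2 * σ ≤ δ := by linarith
  have hr₂0 : 0 ≤ ρ + 2 * σ := by linarith
  have hr₂1 : ρ + 2 * σ ≤ ρ + 3 * σ := by linarith
  have hr₂δ' : ρ + 2 * σ + σ ≤ δ := by linarith
  have hr₂δ : ρ + 2 * σ ≤ δ := by linarith
  have hρr₂ : ρ + 2 * σ ≤ ρ + 2 * σ := le_rfl
  -- the G₁-entries G₁F, G₁D, G₁Q* by r1's Neumann bookkeeping, at the rate ρ + 3σ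
  have pG := entry_l2w_of_step hG hWi hWi (Eop := LinearMap.id) (Fop := F) (aS := B₂) (aE := B₂) (aEF := B₂) hrow hB₂
    hθ hB₂ hB₂ hB₂ hr₁0 hσ hr₁δ hL hT (hF5.mono fun y y' => le_of_eq (by ring))
    (by rw [LinearMap.id_comp]; exact hL.l0.mono fun y y' => le_of_eq (by rw [inv_inv]; ring))
    (by rw [LinearMap.id_comp]; exact hF5.mono fun y y' => le_of_eq (by rw [inv_inv]; ring)) hfix hq
  rw [LinearMap.id_comp] at pG
  have pGD := entry_l2w_of_step hG hW1 hWi (Eop := LinearMap.id) (Fop := 𝔬.Dv U) (aS := B₄) (aE := B₂) (aEF := B₄) hrow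
    hB₂ hθ hB₄ hB₂ hB₄ hr₁0 hσ hr₁δ hL hT (hLt.gDv.mono fun y y' => le_of_eq (by ring))
    (by rw [LinearMap.id_comp]; exact hL.l0.mono fun y y' => le_of_eq (by rw [inv_inv]; ring))
    (by rw [LinearMap.id_comp]; exact hLt.gDv.mono fun y y' => le_of_eq (by rw [inv_inv]; ring)) hfix hq
  rw [LinearMap.id_comp] at pGD
  have pGQ := entry_l2w_of_step hG hWv hWi (Eop := LinearMap.id) (Fop := 𝔬.Qstar U) (aS := B₄) (aE := B₂) (aEF := B₄) hrow
    hB₂ hθ hB₄ hB₂ hB₄ hr₁0 hσ hr₁δ hL hT (hLt.gQs.mono fun y y' => le_of_eq (by ring))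
    (by rw [LinearMap.id_comp]; exact hL.l0.mono fun y y' => le_of_eq (by rw [inv_inv]; ring))
    (by rw [LinearMap.id_comp]; exact hLt.gQs.mono fun y y' => le_of_eq (by rw [inv_inv]; ring)) hfix hq
  rw [LinearMap.id_comp] at pGQ
  -- the letters RD*G₁F, C₁, Q in the block-L² classes
  have pRG : HasMaj (l2w (toB6 g R₀ H₀) blk₀ (fun y : g.Site => (g.len y)⁻¹) fun y => (hWi y).le)
      (l2w (toB6 g R₀ H₀) 𝔬.blkW (fun _ : g.Site => (1 : ℝ)) fun y => (hW1 y).le)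
      (𝔬.R U ∘ₗ 𝔬.Dvstar U ∘ₗ 𝔬.G1 U ∘ₗ F) (fun y y' => B₄ * Real.exp (-(δ * g.dist y y'))) :=
    hasMaj_l2w_of_blockBd_ratio (g := toB6 g R₀ H₀) hWi hW1 (hrgdF.mono fun y y' => le_of_eq (by ring))
  have pC : HasMaj (l2w (toB6 g R₀ H₀) 𝔬.blkZ (fun y : g.Site => (vZ y * g.len y)⁻¹) fun y => (hWvi y).le)
      (l2w (toB6 g R₀ H₀) 𝔬.blkZ (fun y : g.Site => vZ y * g.len y) fun y => (hWv y).le)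
      (𝔬.C1 U) (fun y y' => B₄ * Real.exp (-(δ * g.dist y y'))) :=
    hasMaj_l2w_of_blockBd_ratio (g := toB6 g R₀ H₀) hWvi hWv (hLt.c1.mono fun y y' => le_of_eq (by ring))
  have pQ : HasMaj (l2w (toB6 g R₀ H₀) 𝔬.blk (fun y : g.Site => (g.len y)⁻¹) fun y => (hWi y).le)
      (l2w (toB6 g R₀ H₀) 𝔬.blkZ (fun y : g.Site => (vZ y * g.len y)⁻¹) fun y => (hWvi y).le)
      (𝔬.Q U) (fun y y' => B₄ * Real.exp (-(δ * g.dist y y'))) :=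
    hasMaj_l2w_of_blockBd_ratio (g := toB6 g R₀ H₀) hWi hWvi (hLt.q.mono fun y y' => le_of_eq (by rw [inv_inv]; ring))
  -- QG₁F at the rate ρ + 2σ
  have pQG := hasMaj_comp_exp htri hG.dnn hrow hB₄ hP₂0 hr₂0 hr₂1 hr₂δ' pQ pG
  simp only [l2w_κ, one_mul] at pQG
  -- everything at (K_p, ρ + 2σ), the composite at K_p²c
  have uG := hasMaj_up hG hP₂0 hP₂le hr₂1 pG
  have uGD := hasMaj_up hG hP₄0 hP₄le hr₂1 pGD
  have uRG := hasMaj_up hG hB₄ hB₄K hr₂δ pRG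
  have uGQ := hasMaj_up hG hP₄0 hP₄le hr₂1 pGQ
  have uC := hasMaj_up hG hB₄ hB₄K hr₂δ pC
  have uQG := hasMaj_up hG (mul_nonneg (mul_nonneg hB₄ hP₂0) hc)
    (mul_le_mul_of_nonneg_right (mul_le_mul hB₄K hP₂le hP₂0 hKp0) hc) hρr₂ pQG
  -- (3.153) composed in the block-L² classes, then unweighted and transferred
  have hfr := hasMaj_frakG_classes htri hG.dnn hrow hKp0 hKp0 hKp0 hKp0 hKp0 hKK0 hρ hσ hρr₂ uG uGD uRG uGQ uC uQG
  have hGG := hfr.congr (T' := 𝔬.GG U ∘ₗ F) fun μ => by rw [GG_comp_eq hI F]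
  have hbd := blockBd_of_hasMaj_l2w hGG hWi
  have h' : BlockBd (g := toB6 g R₀ H₀) blk₀ 𝔬.blk (𝔬.GG U ∘ₗ F)
      (fun (y y' : g.Site) => constG46 (constKp B₂ B₄ θ c) c * (g.len y' ^ (-1 : ℝ) * (g.len y ^ (-1 : ℝ))⁻¹) *
        Real.exp (-(ρ * g.dist y y'))) :=
    hbd.mono fun y y' => le_of_eq (by
      simp only [l2w_κ, one_mul, toB6_dist, constG46, constKp, Real.rpow_neg_one, div_eq_mul_inv]; ring)
  exact blockBd_transfer (C := fun _ _ => constG46 (constKp B₂ B₄ θ c) c) (fun _ _ => hKG0)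
    (fun z => Real.rpow_pos_of_pos (hG.lenpos z) (-1)) hST h'

end L2GP

end

end Literature.MathematicalPhysics.QuantumFieldTheory.Balaban1983to89.B9Thm313WholeL2GPZ
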